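import Summits.BirchSwinnertonDyer.BirchSwinnertonDyer.Theorems.KolyvaginDepthDoorMSymbolCert707a1Twist19
import Summits.BirchSwinnertonDyer.BirchSwinnertonDyer.Theorems.KolyvaginDepthDoorDepthTableKuriharaRow389a1CertifiedT
import Summits.BirchSwinnertonDyer.BirchSwinnertonDyer.Theorems.KolyvaginDepthDoorDepthTableKuriharaRow707a1p5CertifiedE
import Summits.BirchSwinnertonDyer.BirchSwinnertonDyer.Theorems.KolyvaginDepthDoorDepthTableRowsIntrinsic4
import Summits.BirchSwinnertonDyer.Rank1Residual.Supersingular.CountPointsFast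
import Literature.NumberTheory.EllipticCurves.BurungaleSkinnerTianWan2024.CyclotomicPConverseOverQProofs
import Literature.NumberTheory.EllipticCurves.BSDSelmerPConverseSerreProofs
import HarnessLib

/-!
# Route `KolyvaginDepthDoor`, crux `KolyvaginDepthSupplyKN` (stmt-BirchSwinnertonDyer-22820) —
# DEPTH TABLE v29 «THE CHEAPEST ADMISSIBLE PRIME»: the COMPOSITE-conductor row `707a1` @ `(5, −19)` with BOTH Kurihara claims PROVED

Helper file of the lead prover of line `levelone` (kdd-p1 g34; `--supports stmt-BirchSwinnertonDyer-22820 --as helper`); it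
closes nothing and BSD is NOT proved by it. Sibling of `…KuriharaRow446d1Neg23CertifiedT` / `…794a1Neg23CertifiedT` at the prime `5`
(the lineage's sockets for `707a1` sit at its prime of record; at `5` every side condition of `E = 707a1` is a kernel theorem of the v24
decisive-pair row `…DecisivePair707a1p5(Cert)`, and the E-side claim at the cyclic level `10721 = 71·151` is `C707a1.kuriharaClaim_5_10721`
of `…Row707a1p5CertifiedE`): §1 the Kurihara data of `T₀ = 707a1 ⊗ χ₋₁₉ = ⟨0, -1, 1, -4452, -110483⟩` at `(5, 331)` (`331` a cyclic Kolyvagin prime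
of `(T₀, 5)`: `#T̃₀(𝔽_331) = 360`; table `tab331` (base `3`, NEW, split literal, chunked check); the twisted minus sums `sigmaT` of `…MSymbolCert707a1Twist19`; `kSumT ≡ 2
(mod 5)`); §2 `exists_kuriharaNumber_ne_zero_T0` (|C|₅ = 1); §3 `C707a1.minTwist19_isCyclicKolyvaginLevel_5_331`, `C707a1.minTwist19_nonAnomalous_5`,
**`C707a1.kuriharaClaimT_5_331`** and **`C707a1.cruxBody_of_print_5_neg19`** — the clause of `KolyvaginDepthSupplyKN` at `W = 707a1` for every
`K` with `d_K = −19`, by v17's generic `cruxBody_of_kuriharaClaims_spade` with BOTH claims discharged, conditional on the four print facts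
(Kim Thm 1.11, modularity, Mazur Cor 4.1, W. Zhang L8.4 (1)/9.1) ONLY. Per curve; nothing class-wide.

References: [Kim2022StructureSelmer] Thm. 1.11, §1.4.3; [MazurTateTeitelbaum1986Invent] §I.8; [CremonaAlgorithms1997] §2.8, Table 1 (707a1);
[WZhang2014] L8.4 (1), Thm. 9.1; [Mazur1978] Cor. 4.1; [GrossLMS1991] Prop. 3.7 (2); [Serre1972] §4.2.
-/

set_option linter.dupNamespace false

noncomputable section

open scoped MatrixGroups ModularForm Classical NumberField
open CongruenceSubgroup
open Literature.NumberTheory.EllipticCurves Literature.NumberTheory.EllipticCurves.ModularForms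
open Literature.NumberTheory.EllipticCurves.BurungaleSkinnerTianWan2024
  (hasIrreducibleModPGaloisRep_of_smul_eq_quadraticTwist)
open Summit.BirchSwinnertonDyer.BirchSwinnertonDyer.Rank2Observatory
open Summit.BirchSwinnertonDyer.BirchSwinnertonDyer.Theorems.KolyvaginDepthDoor.MSymbolCert.Cert389a1
  (exists_mul_eq_half kuriharaNumber_ne_zero_of_const)
open Summit.BirchSwinnertonDyer.BirchSwinnertonDyer.Theorems.KolyvaginDepthDoor (C707a1.minTwist19_isElliptic
  C707a1.minTwist19_isGloballyMinimal C707a1.minTwist19_intModel C707a1.minTwist19_smul_eq)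

namespace Summit.BirchSwinnertonDyer.BirchSwinnertonDyer.Theorems.KolyvaginDepthDoor.MSymbolCert.Cert707a1

/-! ## §1 The Kurihara data of `T₀` at `(5, 331)` -/

/-- Discrete-log table modulo `331`, base `3` (values mod `5` used): first `165` entries (a `331`-entry literal would exceed
the elaborator's recursion depth). [folklore] -/
def tab331a : List ℕ := [0, 0, 121, 1, 242, 236, 122, 81, 33, 2, 27, 137, 243, 145, 202, 237, 154, 184, 123, 14, 148, 82, 258, 295, 34, 142, 266, 3, 323, 271, 28, 220, 275, 138, 305, 317, 244, 119, 135, 146, 269, 133, 203, 112, 49, 238, 86, 205, 155, 162, 263, 185, 57, 188, 124, 43, 114, 15, 62, 173, 149, 195, 11, 83, 66, 51, 259, 6, 96, 296, 108, 128, 35, 69, 240, 143, 256, 218, 267, 160, 60, 4, 254, 88, 324, 90, 233, 272, 170, 230, 29, 226, 207, 221, 326, 250, 276, 103, 283, 139, 54, 157, 306, 92, 178, 318, 309, 191, 245, 76, 164, 120, 235, 32, 136, 201, 183, 147, 294, 265, 270, 274, 316, 134, 132, 48, 204, 262, 187, 113, 172, 10, 50, 95, 127, 239, 217, 59, 87,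 232, 229, 206, 249, 282, 156, 177, 190, 163, 31, 182, 264, 315, 47, 186, 9, 126, 58, 228, 281, 189, 181, 46, 125, 280, 45]

/-- Discrete-log table modulo `331`, base `3`: entries `165 …`. [folklore] -/
def tab331b : List ℕ := [44, 209, 210, 115, 290, 211, 16, 24, 116, 63, 223, 291, 174, 21, 212, 150, 99, 17, 196, 328, 25, 12, 321, 117, 84, 41, 64, 67, 252, 224, 52, 74, 292, 260, 215, 175, 7, 278, 22, 97, 39, 213, 297, 299, 151, 109, 105, 100, 129, 312, 18, 36, 301, 197, 70, 285, 329, 241, 80, 26, 144, 153, 13, 257, 141, 322, 219, 304, 118, 268, 111, 85, 161, 56, 42, 61, 194, 65, 5, 107, 68, 255, 159, 253, 89, 169, 225, 325, 102, 53, 91, 308, 75, 234, 200, 293, 273, 131, 261, 171, 94, 216, 231, 248, 176, 30, 314, 8, 227, 180, 279, 208, 289, 23, 222, 20, 98, 327, 320, 40, 251, 73, 214, 277, 38, 298, 104, 311, 300, 284, 79, 152, 140, 303, 110, 55, 193, 106, 158, 168, 101, 307, 199, 130, 93, 247, 313, 179, 288, 19, 319, 72, 37, 310, 78, 302, 192,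 167, 198, 246, 287, 71, 77, 166, 286, 165]

/-- Discrete-log table modulo `331`, base `3` (the two halves appended). [folklore] -/
def tab331 : List ℕ := tab331a ++ tab331b

set_option maxHeartbeats 4000000 in
/-- Table check modulo `331` (decide, in two chunks of the outer variable). [folklore] -/
theorem tabOK_331 : tabOK 331 5 tab331 = true := by
  have h0 : (List.range' 0 166).all (fun a => (List.range 331).all fun b =>
      (a == 0) || (b == 0) || (tabVal tab331 5 ((a * b) % 331) == tabVal tab331 5 a + tabVal tab331 5 b)) = true := by decide +kernel
  have h1 : (List.range' 166 165).all (fun a => (List.range 331).all fun b =>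
      (a == 0) || (b == 0) || (tabVal tab331 5 ((a * b) % 331) == tabVal tab331 5 a + tabVal tab331 5 b)) = true := by decide +kernel
  rw [tabOK, List.all_eq_true]
  intro a ha
  rw [List.mem_range] at ha
  rw [List.all_eq_true] at h0 h1
  by_cases c0 : a < 166
  · exact h0 a (List.mem_range'_1.mpr ⟨by omega, by omega⟩)
  exact h1 a (List.mem_range'_1.mpr ⟨by omega, by omega⟩)

/-- Surjectivity of the table modulo `331` onto `ℤ/5` (decide). [folklore] -/
theorem tabSurj_331 : tabSurj 331 5 tab331 = true := by
  decide +kernel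

/-- The table family for `m = 331`. [folklore] -/
def Tw6289 (ℓ : ℕ) : List ℕ := if ℓ = 331 then tab331 else []

/-- Admissibility of the table family. [folklore] -/
theorem Tw6289_ok : ∀ ℓ, Tw6289 ℓ = [] ∨ (ℓ.Prime ∧ tabOK ℓ 5 (Tw6289 ℓ) = true) := by
  intro ℓ
  by_cases h : ℓ = 331
  · right
    rw [h, Tw6289, if_pos rfl]
    exact ⟨by norm_num, tabOK_331⟩
  · left; simp [Tw6289, h]

/-- Surjectivity at the prime factors of `331`. [folklore] -/
theorem Tw6289_surj : ∀ ℓ ∈ (331 : ℕ).primeFactors, tabSurj ℓ 5 (Tw6289 ℓ) = true := by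
  rw [show (331 : ℕ).primeFactors = {331} from Nat.Prime.primeFactors (by norm_num)]
  intro ℓ hℓ
  rw [Finset.mem_singleton] at hℓ
  rw [hℓ, Tw6289, if_pos rfl]
  exact tabSurj_331

/-- The unit witness `sigmaT 2 = -3` (`5 ∤ -3`; decide). [folklore] -/
theorem sigmaT_witness : sigmaT 2 = (-3) := by
  decide +kernel

set_option maxHeartbeats 4000000 in
/-- **The twisted Kurihara sum is `≢ 0 (mod 5)`** (decide in 4 chunks: `≡ 2`). [cite: Kim2022StructureSelmer, §1.4.3] -/
theorem kSumT_ne_zero : kSum 5 331 sigmaT (331 : ℕ).primeFactors Tw6289 ≠ 0 := by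
  rw [show (331 : ℕ).primeFactors = {331} from Nat.Prime.primeFactors (by norm_num), kSum,
    sum_range_eq_of_chunks4 _ 331 83 83 83 82 rfl ((2 : ℕ) : ZMod 5) ((4 : ℕ) : ZMod 5) ((4 : ℕ) : ZMod 5) ((2 : ℕ) : ZMod 5) ?h0 ?h1 ?h2 ?h3]
  · decide
  · decide +kernel
  · decide +kernel
  · decide +kernel
  · decide +kernel

/-! ## §2 The Kurihara number of the newform of `T₀` -/

/-- **`δ̃_{331}(T₀) ≢ 0 (mod 5)` from modularity of `707a1` by name.** [cite: Kim2022StructureSelmer, §1.4.3] [cite: MazurTateTeitelbaum1986Invent, §I.8] -/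
theorem exists_kuriharaNumber_ne_zero_T0 (hnf : exists_isNewformOf) (N : ℕ) (hN : N = 255227) [NeZero N]
    (D : haveI := C707a1.minTwist19_isElliptic; ModularParametrizationData T0 N) :
    ∃ ψ : (ℓ : ℕ) → (ZMod ℓ)ˣ →* Multiplicative (ZMod 5),
      (∀ ℓ ∈ (331 : ℕ).primeFactors, Function.Surjective (ψ ℓ)) ∧ kuriharaNumber D.f 5 331 ψ ≠ 0 := by
  subst hN
  haveI := C707a1.minTwist19_isElliptic
  haveI := C707a1.minTwist19_isGloballyMinimal
  haveI := isElliptic_c707a1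
  haveI := isGloballyMinimal_c707a1
  haveI : Fact (Nat.Prime 5) := ⟨by norm_num⟩
  haveI : NeZero (331 : ℕ) := ⟨by norm_num⟩
  have hg := D.isNewformOf
  obtain ⟨C, hCall, hCval⟩ := exists_const_T0 hnf D.f hg
  obtain ⟨k, hk⟩ := exists_mul_eq_half D.f hg.1 hg.coeffField_eq_bot hCall
  have hirrE : (((⟨0, 1, 1, -12, 12⟩ : WeierstrassCurve ℤ).map (Int.castRingHom ℚ))).HasIrreducibleModPGaloisRep 5 :=
    hasIrreducibleModPGaloisRep_of_hasSurjectiveModNGaloisRep _ 5 C707a1.hasSurjectiveModNGaloisRep_5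
  have hirr : T0.HasIrreducibleModPGaloisRep 5 :=
    hasIrreducibleModPGaloisRep_of_smul_eq_quadraticTwist (((⟨0, 1, 1, -12, 12⟩ : WeierstrassCurve ℤ).map (Int.castRingHom ℚ))) T0 5 (d := -19) (by norm_num)
      C707a1.minTwist19_smul_eq hirrE
  have hle : ‖((ratPlusSymbol D.f (((2 : ℕ) : ℚ) / 331) : ℚ) : ℚ_[5])‖ ≤ 1 := by
    refine IsNewformOf.norm_ratPlusSymbol_le_one hg (by norm_num) hirr ?_
    have hden : (((2 : ℕ) : ℚ) / 331).den = 331 := by norm_num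
    rw [hden]; norm_num
  rw [hCval 2 (by norm_num) (by norm_num), sigmaT_witness] at hle
  have h2 : ‖(2 : ℚ_[5])‖ = 1 := by
    have := (Padic.norm_natCast_eq_one_iff (p := 5) (n := 2)).mpr (by norm_num)
    simpa using this
  have hv : ‖(((((-3)) : ℤ) : ℚ) : ℚ_[5])‖ = 1 := by
    rw [Rat.cast_intCast]
    refine le_antisymm (Padic.norm_int_le_one _) (not_lt.mp fun hlt => ?_)
    exact absurd (Padic.norm_intCast_lt_one_iff.mp hlt) (by norm_num)
  have hle' : ‖(C : ℚ_[5])‖ ≤ 1 := by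
    have e : ((C * ((((-3)) : ℤ) : ℚ) : ℚ) : ℚ_[5]) = (C : ℚ_[5]) * (((((-3)) : ℤ) : ℚ) : ℚ_[5]) := by push_cast; ring
    rw [e, norm_mul, hv, mul_one] at hle
    exact hle
  have hk1 : ‖((k : ℤ) : ℚ_[5])‖ ≤ 1 := Padic.norm_int_le_one k
  have hprod : ‖(C : ℚ_[5])‖ * ‖((k : ℤ) : ℚ_[5])‖ = 1 := by
    have e : ((C * k : ℚ) : ℚ_[5]) = (C : ℚ_[5]) * ((k : ℤ) : ℚ_[5]) := by push_cast; ring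
    rw [← norm_mul, ← e, hk]
    push_cast
    rw [norm_div, norm_one, h2]; norm_num
  have hC7 : ‖(C : ℚ_[5])‖ = 1 := by
    apply le_antisymm hle'
    nlinarith [norm_nonneg (C : ℚ_[5]), norm_nonneg ((k : ℤ) : ℚ_[5])]
  have hCq : (C : ℚ_[5]) = ((C.num : ℤ) : ℚ_[5]) / ((C.den : ℕ) : ℚ_[5]) := by
    rw [← Rat.cast_intCast, ← Rat.cast_natCast, ← Rat.cast_div, Rat.num_div_den]
  have hdpos : 0 < ‖((C.den : ℕ) : ℚ_[5])‖ := norm_pos_iff.mpr (by exact_mod_cast C.den_ne_zero)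
  have hC7' : ‖((C.num : ℤ) : ℚ_[5])‖ = ‖((C.den : ℕ) : ℚ_[5])‖ := by
    rw [hCq, norm_div, div_eq_one_iff_eq hdpos.ne'] at hC7
    exact hC7
  have hden : ¬ 5 ∣ C.den := fun h => by
    have hlt : ‖((C.den : ℕ) : ℚ_[5])‖ < 1 := Padic.norm_natCast_lt_one_iff.mpr h
    have hnumlt : ‖((C.num : ℤ) : ℚ_[5])‖ < 1 := by rw [hC7']; exact hlt
    have h7num : (5 : ℤ) ∣ C.num := Padic.norm_intCast_lt_one_iff.mp hnumlt
    have hg7 : (5 : ℕ) ∣ Nat.gcd C.num.natAbs C.den := Nat.dvd_gcd (Int.natAbs_dvd_natAbs.mpr h7num) h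
    rw [C.reduced] at hg7
    omega
  have hnum : ¬ (5 : ℤ) ∣ C.num := fun h => by
    have hlt : ‖((C.num : ℤ) : ℚ_[5])‖ < 1 := Padic.norm_intCast_lt_one_iff.mpr h
    have hden1 : ‖((C.den : ℕ) : ℚ_[5])‖ = 1 :=
      Padic.norm_natCast_eq_one_iff.mpr ((Nat.Prime.coprime_iff_not_dvd (by norm_num)).mpr hden)
    rw [hden1] at hC7'
    linarith
  refine ⟨tabFamily 5 Tw6289 Tw6289_ok, fun ℓ hℓ =>
    surjective_tabFamily 5 Tw6289 Tw6289_ok (Nat.prime_of_mem_primeFactors hℓ) (Tw6289_surj ℓ hℓ), ?_⟩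
  exact kuriharaNumber_ne_zero_of_const D.f 5 331 (by norm_num) Tw6289 Tw6289_ok sigmaT C hnum hden
    (fun a ha hac => hCval a ha hac) kSumT_ne_zero

end Summit.BirchSwinnertonDyer.BirchSwinnertonDyer.Theorems.KolyvaginDepthDoor.MSymbolCert.Cert707a1

/-! ## §3 The row: both claims discharged -/

namespace Summit.BirchSwinnertonDyer.BirchSwinnertonDyer.Theorems.KolyvaginDepthDoor

open WeierstrassCurve NumberField IsDedekindDomain
open Summit.BirchSwinnertonDyer.BirchSwinnertonDyer.Theorems
open Summit.BirchSwinnertonDyer.BirchSwinnertonDyer.Rank1Residual (IntModel.frobeniusTrace_eq)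
open Summit.BirchSwinnertonDyer.Rank1Residual.Supersingular (natCard_point_eq_of_countPoints countPoints_eq_of_fast)
open Summit.BirchSwinnertonDyer.Rank1Residual.Additive (card_torsion_le_of_intModel_of_card isKolyvaginPrime_of_intModel_of_card)

namespace C707a1

/-- `#T̃₀(𝔽_331) = 360` for `T₀ = ⟨0, -1, 1, -4452, -110483⟩` (`331 ≡ 1 (mod 5)`, `a_331(T₀) = -28 ≡ 2 (mod 5)`, `25 ∤ 360`), kernel-decided
(`countPointsFast`). [cite: Kim2022StructureSelmer, §1.2.2 (PDF p. 5)] -/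
theorem minTwist19_card_331 :
    Nat.card (((⟨0, -1, 1, -4452, -110483⟩ : WeierstrassCurve ℤ).map (Int.castRingHom (ZMod 331))).toAffine.Point) = 360 :=
  haveI : Fact (Nat.Prime 331) := ⟨by norm_num⟩
  natCard_point_eq_of_countPoints 0 (-1) 1 (-4452) (-110483) 331 (by norm_num) (by decide +kernel) (n := 360)
    (countPoints_eq_of_fast (by decide +kernel))

/-- **`331` is a CYCLIC KOLYVAGIN PRIME for `(T₀, 5)`** (`331 ∤ 5·N_{T₀}`, `331 ≡ 1`, `a_331(T₀) ≡ 2 (mod 5)`, `#T̃₀(𝔽_331)[5] ≤ 5`).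
[cite: Kim2022StructureSelmer, §1.2.2 (PDF p. 5)] -/
theorem minTwist19_isCyclicKolyvaginLevel_5_331 :
    haveI := minTwist19_isGloballyMinimal; haveI := Fact.mk (by norm_num : Nat.Prime 5);
    IsCyclicKolyvaginLevel (((⟨0, -1, 1, -4452, -110483⟩ : WeierstrassCurve ℤ).map (Int.castRingHom ℚ))) 5 331 := by
  haveI := minTwist19_isElliptic
  haveI := minTwist19_isGloballyMinimal
  haveI := Fact.mk (by norm_num : Nat.Prime 5)
  haveI : Fact (Nat.Prime 331) := ⟨by norm_num⟩
  have hℓ : Kato.IsKolyvaginPrime (((⟨0, -1, 1, -4452, -110483⟩ : WeierstrassCurve ℤ).map (Int.castRingHom ℚ))) 5 1 331 :=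
    isKolyvaginPrime_of_intModel_of_card minTwist19_intModel 5 1 331 (by norm_num) (by decide +kernel) (by decide)
      minTwist19_card_331 (by norm_num)
  refine ⟨⟨Nat.squarefree_iff_nodup_primeFactorsList (by norm_num) |>.mpr (by simp), fun ℓ hℓ' ↦ ?_⟩, fun ℓ hℓ' hdvd ↦ ?_⟩
  · rw [show (331 : ℕ).primeFactors = {331} from (Nat.Prime.primeFactors (by norm_num)), Finset.mem_singleton] at hℓ'
    exact hℓ' ▸ hℓ
  · obtain rfl := (Nat.prime_dvd_prime_iff_eq hℓ'.out (by norm_num)).mp hdvd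
    exact card_torsion_le_of_intModel_of_card minTwist19_intModel 5 331 minTwist19_card_331 (by norm_num)

/-- **`5` is non-anomalous for `T₀`**: `a_5(T₀) = -3` (`5` splits in `ℚ(√−19)`, `a_5(T₀) = a_5(E)`), `5 ∤ a_5(T₀) − 1`.
[cite: SilvermanAEC2009, VII.3 Prop. 3.1] -/
theorem minTwist19_nonAnomalous_5 :
    haveI := minTwist19_isGloballyMinimal; haveI := Fact.mk (by norm_num : Nat.Prime 5);
    ¬ ((5 : ℕ) : ℤ) ∣ (((⟨0, -1, 1, -4452, -110483⟩ : WeierstrassCurve ℤ).map (Int.castRingHom ℚ))).frobeniusTrace 5 - 1 := by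
  haveI := minTwist19_isElliptic
  haveI := minTwist19_isGloballyMinimal
  haveI := Fact.mk (by norm_num : Nat.Prime 5)
  rw [IntModel.frobeniusTrace_eq minTwist19_intModel minTwist19_card_5]
  decide

/-- **THE TWIST-SIDE KURIHARA CLAIM OF ROW `707a1` @ `(5, −19)` FROM MODULARITY BY NAME** (claim for `T₀` @ `(5, 331)`).
[cite: Kim2022StructureSelmer, §1.4.3] [cite: MazurTateTeitelbaum1986Invent, §I.8] -/
theorem kuriharaClaimT_5_331 (hnf : exists_isNewformOf) :
    haveI := minTwist19_isElliptic; haveI := minTwist19_isGloballyMinimal;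
    haveI : NeZero ((((⟨0, -1, 1, -4452, -110483⟩ : WeierstrassCurve ℤ).map (Int.castRingHom ℚ))).conductorNorm ℤ) := neZero_conductorNorm_of_isElliptic _;
    haveI := Fact.mk (by norm_num : Nat.Prime 5);
      ∀ (D : ModularParametrizationData (((⟨0, -1, 1, -4452, -110483⟩ : WeierstrassCurve ℤ).map (Int.castRingHom ℚ))) ((((⟨0, -1, 1, -4452, -110483⟩ : WeierstrassCurve ℤ).map (Int.castRingHom ℚ))).conductorNorm ℤ)),
      ¬ ((5 : ℕ) : ℤ) ∣ D.maninConstant →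
      (∃ u : ℚ, ‖(u : ℚ_[5])‖ = 1 ∧ (((⟨0, -1, 1, -4452, -110483⟩ : WeierstrassCurve ℤ).map (Int.castRingHom ℚ))).realPeriodRat = u * plusPeriod D.f) →
      ∃ ψ : (ℓ : ℕ) → (ZMod ℓ)ˣ →* Multiplicative (ZMod 5),
        (∀ ℓ ∈ (331 : ℕ).primeFactors, Function.Surjective (ψ ℓ)) ∧ kuriharaNumber D.f 5 331 ψ ≠ 0 := by
  intro D _ _
  haveI := minTwist19_isElliptic
  haveI : NeZero ((((⟨0, -1, 1, -4452, -110483⟩ : WeierstrassCurve ℤ).map (Int.castRingHom ℚ))).conductorNorm ℤ) := neZero_conductorNorm_of_isElliptic _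
  exact MSymbolCert.Cert707a1.exists_kuriharaNumber_ne_zero_T0 hnf _ MSymbolCert.Cert707a1.conductorNorm_T0 D

/-- **DEPTH-TABLE ROW `707a1` (COMPOSITE CONDUCTOR `7·101`), `(p, d_K) = (5, −19)`, v29 «THE CHEAPEST ADMISSIBLE PRIME» — NO
COMPUTATIONAL CLAIM LEFT.** For every imaginary quadratic `K` with `d_K = −19`: granted Kim's Thm. 1.11 (`hKim`), modularity (`hnf`),
Mazur's Cor. 4.1 (`hMaz`), W. Zhang's L8.4 (1)/9.1 (`h84`) BY NAME, the clause of the crux `KolyvaginDepthSupplyKN` holds at `W = 707a1`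
VERBATIM: v17's generic `cruxBody_of_kuriharaClaims_spade` at `p = 5` (admissible for `707a1`: good ordinary, `ρ̄_{E,5}` onto + Serre's
tower, non-anomalous, Kodaira–Néron, ♠ (1); all kernel theorems of the lineage) with the E-side claim `kuriharaClaim_5_10721`
(`…Row707a1p5CertifiedE`) and the twist-side claim `kuriharaClaimT_5_331` at the cyclic Kolyvagin prime `331` of `(T₀, 5)` BOTH
PROVED. CONDITIONAL on the four named print facts ONLY; per curve; nothing class-wide; BSD is not proved by it.
[cite: Kim2022StructureSelmer, Thm. 1.11 (PDF p. 8)] [cite: WZhang2014, Lemma 8.4 (1) (p. 236), Thm. 9.1 (p. 240)] [cite: Mazur1978, Cor. 4.1]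
[cite: Serre1972, §4.2 Thm. 2] [cite: CremonaAlgorithms1997, Table 1 (707a1)] -/
theorem cruxBody_of_print_5_neg19
    (hKim : Kim2022_card_selmerGroup_le_pow_of_kuriharaNumber_ne_zero)
    (hnf : exists_isNewformOf) (hMaz : mazur_not_dvd_maninConstant_of_odd)
    (h84 : Literature.NumberTheory.EllipticCurves.WZhang2014_lemma84_exists_minimal_kolyvaginClass_one_selmerCard)
    (K : Type) [Field K] [NumberField K] (hK : IsImaginaryQuadratic K) (hD : NumberField.discr K = -19) :
    haveI := isElliptic_c707a1; haveI := isGloballyMinimal_c707a1;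
    ∃ (p : ℕ) (hp : Fact p.Prime), 5 ≤ p ∧ (((⟨0, 1, 1, -12, 12⟩ : WeierstrassCurve ℤ).map (Int.castRingHom ℚ))).HasGoodReductionAtPrime p ∧
      ¬ (p : ℤ) ∣ (((⟨0, 1, 1, -12, 12⟩ : WeierstrassCurve ℤ).map (Int.castRingHom ℚ))).frobeniusTrace p ∧
      (∀ n : ℕ, (((⟨0, 1, 1, -12, 12⟩ : WeierstrassCurve ℤ).map (Int.castRingHom ℚ))).HasSurjectiveModNGaloisRep (p ^ n : ℕ)) ∧
      (∀ v : HeightOneSpectrum (𝓞 ℚ), (((⟨0, 1, 1, -12, 12⟩ : WeierstrassCurve ℤ).map (Int.castRingHom ℚ))).HasMultiplicativeReductionAt v →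
        ¬ p ∣ (((⟨0, 1, 1, -12, 12⟩ : WeierstrassCurve ℤ).map (Int.castRingHom ℚ))).ordMinimalDiscriminant v) ∧
      ∃ (K : Type) (_ : Field K) (_ : NumberField K), IsImaginaryQuadratic K ∧
        NumberField.discr K ≠ -3 ∧ NumberField.discr K ≠ -4 ∧
        ∃ (_ : NeZero ((((⟨0, 1, 1, -12, 12⟩ : WeierstrassCurve ℤ).map (Int.castRingHom ℚ))).conductorNorm ℤ)),
          SatisfiesHeegnerHypothesis ((((⟨0, 1, 1, -12, 12⟩ : WeierstrassCurve ℤ).map (Int.castRingHom ℚ))).conductorNorm ℤ) K ∧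
        ∃ (Dt : ModularParametrizationData (((⟨0, 1, 1, -12, 12⟩ : WeierstrassCurve ℤ).map (Int.castRingHom ℚ))) ((((⟨0, 1, 1, -12, 12⟩ : WeierstrassCurve ℤ).map (Int.castRingHom ℚ))).conductorNorm ℤ))
          (β : ℤ) (ι : K →+* ℂ) (n₁ : ℕ) (d : KolyvaginHeegnerData Dt β ι n₁), Squarefree n₁ ∧
          (∀ q ∈ n₁.primeFactors, Zhang2014.IsKolyvaginPrime ((((⟨0, 1, 1, -12, 12⟩ : WeierstrassCurve ℤ).map (Int.castRingHom ℚ))).conductorNorm ℤ)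
            (((⟨0, 1, 1, -12, 12⟩ : WeierstrassCurve ℤ).map (Int.castRingHom ℚ))) K p q) ∧
          d.kolyvaginClass hp.out 1 ≠ 0 ∧
          (n₁.primeFactors.card + 1 ≤ (((⟨0, 1, 1, -12, 12⟩ : WeierstrassCurve ℤ).map (Int.castRingHom ℚ))).mordellWeilRank ∨
            (n₁.primeFactors.card ≤ (((⟨0, 1, 1, -12, 12⟩ : WeierstrassCurve ℤ).map (Int.castRingHom ℚ))).mordellWeilRank ∧
              n₁.primeFactors.card + 1 ≤ ((((⟨0, 1, 1, -12, 12⟩ : WeierstrassCurve ℤ).map (Int.castRingHom ℚ))).quadraticTwist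
                (NumberField.discr K : ℚ)).mordellWeilRank)) := by
  haveI := isElliptic_c707a1
  haveI := isGloballyMinimal_c707a1
  haveI iNZ : NeZero ((((⟨0, 1, 1, -12, 12⟩ : WeierstrassCurve ℤ).map (Int.castRingHom ℚ))).conductorNorm ℤ) := neZero_conductorNorm_of_isElliptic _
  haveI := minTwist19_isElliptic
  haveI := minTwist19_isGloballyMinimal
  haveI iNZT : NeZero ((((⟨0, -1, 1, -4452, -110483⟩ : WeierstrassCurve ℤ).map (Int.castRingHom ℚ))).conductorNorm ℤ) := neZero_conductorNorm_of_isElliptic _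
  haveI iP := Fact.mk (by norm_num : Nat.Prime 5)
  haveI : NeZero (10721 : ℕ) := ⟨by norm_num⟩
  haveI : NeZero (331 : ℕ) := ⟨by norm_num⟩
  have hsp := spadeOne_of_five_le 5 le_rfl
  have hS2 : ¬ Squarefree ((((⟨0, 1, 1, -12, 12⟩ : WeierstrassCurve ℤ).map (Int.castRingHom ℚ))).conductorNorm ℤ) →
      (∃ (ℓ : ℕ) (_ : Fact ℓ.Prime), (((⟨0, 1, 1, -12, 12⟩ : WeierstrassCurve ℤ).map (Int.castRingHom ℚ))).HasMultiplicativeReductionAtPrime ℓ ∧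
          ¬ 5 ∣ padicValInt ℓ (((⟨0, 1, 1, -12, 12⟩ : WeierstrassCurve ℤ).map (Int.castRingHom ℚ))).minimalDiscriminantInt) ∧
        ∃ (ℓ₁ ℓ₂ : ℕ) (_ : Fact ℓ₁.Prime) (_ : Fact ℓ₂.Prime), ℓ₁ ≠ ℓ₂ ∧
          (((⟨0, 1, 1, -12, 12⟩ : WeierstrassCurve ℤ).map (Int.castRingHom ℚ))).HasMultiplicativeReductionAtPrime ℓ₁ ∧ (((⟨0, 1, 1, -12, 12⟩ : WeierstrassCurve ℤ).map (Int.castRingHom ℚ))).HasMultiplicativeReductionAtPrime ℓ₂ :=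
    fun hns ↦ absurd ((((⟨0, 1, 1, -12, 12⟩ : WeierstrassCurve ℤ).map (Int.castRingHom ℚ))).isSemistable_iff_squarefree_conductorNorm.mp hsp.2) hns
  have hH := satisfiesHeegnerHypothesis_conductorNorm_of_intModel intModel K hK.1 hD heegner_neg19
  have hD3 : NumberField.discr K ≠ -3 := by rw [hD]; norm_num
  have hD4 : NumberField.discr K ≠ -4 := by rw [hD]; norm_num
  have hpD : ¬ (((5 : ℕ) : ℤ) ∣ NumberField.discr K) := by rw [hD]; decide
  have hsur : (((⟨0, 1, 1, -12, 12⟩ : WeierstrassCurve ℤ).map (Int.castRingHom ℚ))).HasSurjectiveModNGaloisRep ((5 : ℕ) : ℤ) := by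
    simpa using hasSurjectiveModNGaloisRep_5
  have htower : ∀ k : ℕ, (((⟨0, 1, 1, -12, 12⟩ : WeierstrassCurve ℤ).map (Int.castRingHom ℚ))).HasSurjectiveModNGaloisRep ((5 : ℕ) ^ k : ℕ) :=
    serre_hasSurjectiveModNGaloisRep_pow_holds _ 5 (by norm_num) hsur
  have hC : (⟨1, (-6 : ℚ), (0 : ℚ), -((1 : ℚ) / 2)⟩ : WeierstrassCurve.VariableChange ℚ) • (((⟨0, -1, 1, -4452, -110483⟩ : WeierstrassCurve ℤ).map (Int.castRingHom ℚ))) = (((⟨0, 1, 1, -12, 12⟩ : WeierstrassCurve ℤ).map (Int.castRingHom ℚ))).quadraticTwist (NumberField.discr K : ℚ) := by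
    rw [hD]; push_cast; exact minTwist19_smul_eq
  have hrank : 2 ≤ (((⟨0, 1, 1, -12, 12⟩ : WeierstrassCurve ℤ).map (Int.castRingHom ℚ))).mordellWeilRank :=
    le_of_eq Summit.BirchSwinnertonDyer.BirchSwinnertonDyer.Rank2Observatory.C707a1.mordellWeilRank_eq_two.symm
  have hν' : (10721 : ℕ).primeFactors.card ≤ (((⟨0, 1, 1, -12, 12⟩ : WeierstrassCurve ℤ).map (Int.castRingHom ℚ))).mordellWeilRank := by
    refine le_trans (le_of_eq ?_) hrank
    rw [MSymbolCert.Level10721.primeFactors_10721]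
    decide
  have hμ' : (331 : ℕ).primeFactors.card ≤ (((⟨0, 1, 1, -12, 12⟩ : WeierstrassCurve ℤ).map (Int.castRingHom ℚ))).mordellWeilRank :=
    le_trans (by rw [Nat.Prime.primeFactors (by norm_num), Finset.card_singleton]; norm_num) hrank
  exact cruxBody_of_kuriharaClaims_spade hKim hnf hMaz h84 _ hrank 5 le_rfl goodOrdinary_5.1 goodOrdinary_5.2 htower
    (kodairaNeron_of_five_le 5 le_rfl) nonAnomalous_5 hsp.1 hS2 K hK hD3 hD4 hpD hH 10721 isCyclicKolyvaginLevel_5_10721 hν'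
    kuriharaClaim_5_10721 (((⟨0, -1, 1, -4452, -110483⟩ : WeierstrassCurve ℤ).map (Int.castRingHom ℚ))) _ hC minTwist19_nonAnomalous_5 minTwist19_kodairaNeron_5 331 minTwist19_isCyclicKolyvaginLevel_5_331 hμ'
    (kuriharaClaimT_5_331 hnf)

end C707a1

end Summit.BirchSwinnertonDyer.BirchSwinnertonDyer.Theorems.KolyvaginDepthDoor

end
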